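import Literature.NumberTheory.EllipticCurves.DivisionFieldReducibleBorelKernel
import Literature.NumberTheory.EllipticCurves.FineSelmerClassGroupCriterion
import Literature.NumberTheory.IwasawaTheory.ClassicalMuInvariant
import Literature.NumberTheory.EllipticCurves.Tamagawa
import Literature.NumberTheory.EllipticCurves.GlobalMinimalModel
import HarnessLib

/-!
# Wuthrich 2014 Lemma 14 / Coates–Sujatha (A) on the REDUCIBLE rows, in the kernel modulo two classical
# named facts: for `E/ℚ`, `p` odd, `E[p]` REDUCIBLE, the dual fine Selmer group of `E` over `ℚ_cyc` is
# finitely generated over `ℤ_p` (`μ = 0`) — GIVEN Ferrero–Washington and Lim 2017 Thm. 3.5 (Coates–Sujatha 3.4)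

Seat `bsd-potss-rkm` g15 (prover; cell `bsd-potss`, HOME `run/shared/lean/pub/bsd-potss/`), item
stmt-BirchSwinnertonDyer-19196 `ReducibleKatoMember` = crux M of the routes K9 `KatoDescentPotSupersingular` /
K8-t′ `KatoDescentTamePotSupersingular` (`--supports`, helper; closes nothing).  HONEST FRAMING (cell): BSD is
not proved by any of this; nothing is booked; crux M stays cite-level on {modularity, `Kato2004.exists_member
HullZetaInputs`}.  WHAT THIS FILE DOES: the held zeta package of M carries the clause `mu_H2` («Wuthrich 2014
Lemma 14 + global duality (reducible `W[p]`, `p` odd): `μ(𝐇²(T)⁰) = 0`»); its PRINTED antecedent is Wuthrich's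
Lemma 14 = Coates–Sujatha's statement (A) for curves with a rational `p`-isogeny, whose proof in print is
«the two characters of `E[p]` cut out abelian fields; Ferrero–Washington; [CS] Thm. 3.4».  Here that proof is
run IN THE KERNEL down to the two classical theorems it quotes:

* `Literature.NumberTheory.IwasawaTheory.ferreroWashington1979_classicalMuVanishes` (FW 1979: Iwasawa's
  `μ = 0` for the cyclotomic `ℤ_p`-extension of an abelian number field; typed, cite-level);
* `Lim2017.thm35_fineSelmerDual_moduleFinite_of_classicalMuVanishes_of_le_divisionField` (Lim, Asian J.
  Math. 21 (2017) §3 Thm. 3.5 + Lemma 3.2 + Remark (a) = the `L`-form of Coates–Sujatha 2005 Thm. 3.4: if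
  `ℚ(E[p])` is a finite `p`-extension of `L` and `μ_class(L_cyc) = 0` then (A) holds for `E` at `p`; typed,
  cite-level, by this seat next to its special case `CoatesSujatha2005.thm34_…` (`L = ℚ(E[p])`) in
  `Literature/NumberTheory/EllipticCurves/FineSelmerClassGroupCriterion.lean`, APPEND p565817);

and the Galois theory in between is the tree THEOREM
`WeierstrassCurve.exists_abelian_le_divisionField_of_not_irreducible` (`DivisionFieldReducibleBorelKernel.lean`,
this seat): for reducible `E[p]` the Borel field `M = ℚ(χ₁, χ₂) ⊆ ℚ(E[p])` is finite ABELIAN Galois over `ℚ`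
with `[ℚ(E[p]) : ℚ] = p^k [M : ℚ]`, `k ≤ 1`.  Why the `L`-form is needed: on a reducible NON-split row
`ℚ(E[p])/ℚ` is NOT abelian (its Galois group is a non-abelian subgroup of the Borel), so the typed special
case (`L = ℚ(E[p])`, hypothesis `μ_class(ℚ(E[p])_cyc) = 0`) is not fed by Ferrero–Washington; Lim's theorem
with `L = ℚ(χ₁, χ₂)` is.

RESULT: `fineSelmerDual_moduleFinite_of_not_irreducible` — FW → Lim 3.5 → for every `E/ℚ`, odd `p` with
`E[p]` reducible and every cyclotomic `κ`: `∃ γ D, Module.Finite ℤ_[p] D.X` (the tree's spelling of (A),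
byte-identical with the conclusion of `CoatesSujatha2005.thm34_…`, `DeoRaySujatha2023.thm39_…` and the K9/KT
route nodes `WildFineSelmerCoatesSujatha` / `WildCoatesSujathaResidue` on their (irreducible) rows).  In
particular statement (A) is a KERNEL THEOREM modulo {FW, Lim 3.5} on every X3 row of the cell (B5 O6 wild 3 ×
X3, B4 (t′) X3) — the rows of crux M.

NOT claimed: `μ(𝐇²(T)⁰) = 0` for Kato's `𝐇²` (the package's abstract `H2`; the comparison `𝐇²(T)⁰ ↔ X₀(E/ℚ_∞)`
is the reading flag `Kato-134-H20-fine` of `Kato2004/EulerSystemBoundFineSelmer.lean`, not formalised); no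
discharge of any held child of 19196; no `_holds` of FW or Lim 3.5 (XL / L).
References: [Wuthrich2014] Lemma 14 (p. 396); [CoatesSujatha2005] Thm. 3.4, Cor. 3.5, Cor. 3.6;
[Lim2017FineSelmer] §3 (arXiv:1306.2047 pp. 6–7); [FerreroWashington1979]; [KuriharaPollack2007] §3.1;
[RaySujatha2021] Thm. 2.3; tree `FineSelmerClassGroupCriterion.lean`, `IwasawaTheory/ClassicalMuInvariant.lean`,
`DivisionFieldReducibleBorelKernel.lean`, `KatoFineSelmerDual.lean` (`FineSelmerDualData`).
-/

-- the summit and its single problem are both named `BirchSwinnertonDyer` (registry layout D-0017)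
set_option linter.dupNamespace false
set_option autoImplicit false

noncomputable section

open scoped Classical
open Field WeierstrassCurve Literature.NumberTheory.EllipticCurves Literature.NumberTheory.IwasawaTheory
  Literature.NumberTheory.GaloisRepresentations


namespace Summit.BirchSwinnertonDyer.BirchSwinnertonDyer.Theorems.ReducibleFineSelmerMuZero

open Literature.NumberTheory.EllipticCurves.Lim2017

/-- **Coates–Sujatha's statement (A) on the REDUCIBLE rows (Wuthrich 2014 Lemma 14), in the kernel
modulo Ferrero–Washington and Lim 2017 Thm. 3.5.**  For every elliptic `E/ℚ`, every odd prime `p` with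
`E[p]` REDUCIBLE (`¬ W.HasIrreducibleModPGaloisRep p`, i.e. a rational `p`-isogeny) and every cyclotomic
`ℤ_p`-extension `κ` of `ℚ`: the Pontryagin dual of the fine Selmer group of `E` over `ℚ_cyc` is finitely
generated over `ℤ_p` (`μ = 0`), in the tree's `∃ γ D, Module.Finite ℤ_[p] D.X` spelling.  Proof: the Borel
field `M = ℚ(χ₁, χ₂) ⊆ ℚ(E[p])` of a stable line is finite abelian Galois over `ℚ` with
`[ℚ(E[p]) : ℚ] = p^k [M : ℚ]` (`exists_abelian_le_divisionField_of_not_irreducible`, kernel); FW gives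
`ClassicalMuVanishes` for every cyclotomic `ℤ_p`-extension of `M`; Lim 3.5 + 3.2 gives (A) for `E` at `p`.
CONDITIONAL on the two named facts displayed as hypotheses; nothing else.
[cite: Wuthrich2014, Lemma 14 (p. 396)] [cite: CoatesSujatha2005, Cor. 3.6] [cite: Lim2017FineSelmer, §3 Thm. 3.5, Remark (a)] -/
theorem fineSelmerDual_moduleFinite_of_not_irreducible
    (hLim : thm35_fineSelmerDual_moduleFinite_of_classicalMuVanishes_of_le_divisionField)
    (hFW : ferreroWashington1979_classicalMuVanishes)
    (W : WeierstrassCurve ℚ) [W.IsElliptic] (p : ℕ) [Fact p.Prime] (hp : p ≠ 2)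
    (hred : ¬ W.HasIrreducibleModPGaloisRep p) (κ : ZpExtension ℚ p) (hκ : κ.IsCyclotomic) :
    ∃ (γ : Field.absoluteGaloisGroup ℚ) (D : W.FineSelmerDualData κ γ),
      Module.Finite ℤ_[p] (RestrictScalars ℤ_[p] (IwasawaAlgebra p) D.X) := by
  obtain ⟨M, hMle, hMfin, hMab, k, -, hk⟩ := exists_abelian_le_divisionField_of_not_irreducible (W := W) hred
  haveI : FiniteDimensional ℚ M := hMfin
  haveI : IsAbelianGalois ℚ M := hMab
  haveI : NumberField M := NumberField.mk
  exact hLim W p hp M hMle ⟨k, hk⟩ (fun κL hL => hFW M p κL hL) κ hκ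

/-- The same, on the rows of crux M (`E[p]` reducible at an additive potentially good `p ≠ 2`; the
reduction hypotheses are idle for (A)): statement (A) for `W` at `p`, modulo {FW, Lim 3.5}.
[cite: Wuthrich2014, Lemma 14 (p. 396)] [cite: Kato2004Asterisque, Rem. 12.7 (p. 222) (potentially good)] -/
theorem fineSelmerDual_moduleFinite_of_reducibleRow
    (hLim : thm35_fineSelmerDual_moduleFinite_of_classicalMuVanishes_of_le_divisionField)
    (hFW : ferreroWashington1979_classicalMuVanishes)
    (W : WeierstrassCurve ℚ) [W.IsElliptic] [W.IsGloballyMinimal] (p : ℕ) [Fact p.Prime] (hp : p ≠ 2)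
    (_hg : ¬ W.HasGoodReductionAtPrime p) (_hm : ¬ W.HasMultiplicativeReductionAtPrime p)
    (_hj : 0 ≤ padicValRat p W.j) (hred : ¬ W.HasIrreducibleModPGaloisRep p)
    (κ : ZpExtension ℚ p) (hκ : κ.IsCyclotomic) :
    ∃ (γ : Field.absoluteGaloisGroup ℚ) (D : W.FineSelmerDualData κ γ),
      Module.Finite ℤ_[p] (RestrictScalars ℤ_[p] (IwasawaAlgebra p) D.X) :=
  fineSelmerDual_moduleFinite_of_not_irreducible hLim hFW W p hp hred κ hκ

end Summit.BirchSwinnertonDyer.BirchSwinnertonDyer.Theorems.ReducibleFineSelmerMuZero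

end
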